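import Summits.BirchSwinnertonDyer.Rank1Residual.ManinAdditive.ShimuraFiveFamily
import Literature.NumberTheory.EllipticCurves.KubertTateFiveVeluIsogeny
import HarnessLib

/-!
# The Vélu family `veluFive` of ROAD δ is the tree's Kubert–Tate quotient `E'_{b,1}`
# (cell bsd-f2-manin, es g43; MEMO-es §66.8 P.S.3)

Support lemmas linking the node definition `EsG43.veluFive b = [1 − b, −b, −b, −5b(b² + 2b − 1), −b(b⁴ + 10b³ − 5b² + 15b − 1)]`
(rows E-es-238/239 of `…ManinAdditive.ShimuraFiveFamily`) to the tree's class-wide Vélu quotient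
`KubertTateVelu.kubertTateFive' m n = E_{m,n}/⟨(0,0)⟩` of the universal `5`-torsion curve (`KubertTateFiveVeluIsogeny`):
* `veluFive_eq_kubertTateFive'` — `veluFive b = kubertTateFive' b 1` (definitional, coefficient by coefficient);
* `veluFive_Δ` — `Δ(veluFive b) = b(b² − 11b − 1)⁵`;
* `isElliptic_veluFive` — `veluFive b` is elliptic for every `b ≠ 0` (`t² − 11t − 1` has no rational root, tree
  `sq_sub_eleven_mul_sub_one_ne_zero`);
* `isElliptic_veluFive_pow` — in particular every fibre `veluFive (s⁵)`, `s ≠ 0`, of E-es-238 is elliptic, so the instance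
  binder of `VeluFiveFamilyRootNumberLaw` is always inhabited off `s = 0`;
* `veluFiveFamilyRootNumberLaw_iff` — E-es-238 restated with the explicit hypothesis `s ≠ 0` in place of the instance binder.
Hence the tree's Vélu isogeny `KubertTateVelu.fiveIsogeny b 1 : E_{b,1} → E'_{b,1}` lands in `veluFive b`, and the Kummer function
`f_T = xy − nx² + n²y` of `KubertTateFiveKummerDivisor` (divisor `5(T) − 5(O)`) is the tool for E-es-239 (the extension
`0 → μ₅ → E'_{m,n}[5] → ℤ/5 → 0` has Kummer class `δ(T) = (mn⁴)⁻¹ · ℚˣ⁵`, from `f_T(2T) = m³n²`, `f_T(3T) = −m²n³`, `f_T(4T) = mn⁴`;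
it splits iff `m/n ∈ ℚˣ⁵`).  BSD is not proved here; C2/C3 untouched.
[cite: Velu1971, formulae] [cite: Knapp1993, §V.5 (5.31)] [cite: SilvermanAEC2009, Exercise 10.1(c)]
-/

set_option autoImplicit false
-- lint-debt: the directory name repeats the summit name (sibling precedent `ManinLocalTwoThreeShimuraFiveRootNumber.lean`)
set_option linter.dupNamespace false

noncomputable section

open WeierstrassCurve Literature.NumberTheory.EllipticCurves IsDedekindDomain
open Summit.BirchSwinnertonDyer.Rank1Residual.ManinAdditive Summit.BirchSwinnertonDyer.Rank1Residual.ManinAdditive.EsG43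

namespace Summit.BirchSwinnertonDyer.BirchSwinnertonDyer.Theorems.ManinLocalTwoThree.ShimuraFive

/-- **`veluFive b = E'_{b,1}`**: the node's Vélu family is the tree's Kubert–Tate quotient `kubertTateFive' b 1`.
[cite: Velu1971, formulae] -/
theorem veluFive_eq_kubertTateFive' (b : ℚ) : veluFive b = KubertTateVelu.kubertTateFive' b 1 := by
  ext <;> simp [veluFive, KubertTateVelu.kubertTateFive'] <;> ring

/-- **`Δ(veluFive b) = b(b² − 11b − 1)⁵`.** [cite: Velu1971, formulae] -/
theorem veluFive_Δ (b : ℚ) : (veluFive b).Δ = b * (b ^ 2 - 11 * b - 1) ^ 5 := by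
  rw [veluFive_eq_kubertTateFive', KubertTateVelu.kubertTateFive'_Δ]; ring

/-- **`veluFive b` is an elliptic curve for every rational `b ≠ 0`** (`b² − 11b − 1 ≠ 0` over `ℚ`).
[cite: Knapp1993, §V.5 (5.31)] -/
theorem isElliptic_veluFive {b : ℚ} (hb : b ≠ 0) : (veluFive b).IsElliptic := by
  refine ⟨?_⟩
  rw [veluFive_Δ]
  exact (mul_ne_zero hb (pow_ne_zero 5 (sq_sub_eleven_mul_sub_one_ne_zero b))).isUnit

/-- Every fibre `veluFive (s⁵)` with `s ≠ 0` is elliptic. [cite: Knapp1993, §V.5 (5.31)] -/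
theorem isElliptic_veluFive_pow {s : ℚ} (hs : s ≠ 0) : (veluFive (s ^ 5)).IsElliptic :=
  isElliptic_veluFive (pow_ne_zero 5 hs)

/-- The fibre at `s = 0` is singular (`Δ = 0`), so the instance binder of E-es-238 excludes exactly `s = 0`.
[cite: Velu1971, formulae] -/
theorem not_isElliptic_veluFive_zero : ¬ (veluFive ((0 : ℚ) ^ 5)).IsElliptic := by
  intro h
  have := h.isUnit.ne_zero
  rw [veluFive_Δ] at this
  exact this (by norm_num)

/-- **E-es-238 with an explicit hypothesis**: `VeluFiveFamilyRootNumberLaw` is equivalent to the statement over all `s ≠ 0`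
with the ellipticity instance supplied by `isElliptic_veluFive_pow`. [cite: Rohrlich1993Compositio, Prop. 2] -/
theorem veluFiveFamilyRootNumberLaw_iff :
    VeluFiveFamilyRootNumberLaw ↔
      ∀ (s : ℚ) (hs : s ≠ 0),
        (haveI := isElliptic_veluFive_pow hs
         (veluFive (s ^ 5)).HasAdditiveReductionAt ((Rat.HeightOneSpectrum.primesEquiv (R := ℤ)).symm ⟨5, by norm_num⟩) →
         (veluFive (s ^ 5)).localRootNumberAt ((Rat.HeightOneSpectrum.primesEquiv (R := ℤ)).symm ⟨5, by norm_num⟩) = -1) := by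
  constructor
  · intro h s hs
    haveI := isElliptic_veluFive_pow hs
    exact h s
  · intro h s hE hadd
    have hs : s ≠ 0 := by
      rintro rfl
      exact not_isElliptic_veluFive_zero hE
    have hsub : Subsingleton ((veluFive (s ^ 5)).IsElliptic) := inferInstance
    have heq : hE = isElliptic_veluFive_pow hs := Subsingleton.elim _ _
    subst heq
    exact h s hs hadd

end Summit.BirchSwinnertonDyer.BirchSwinnertonDyer.Theorems.ManinLocalTwoThree.ShimuraFive

end
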